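import Mathlib
import HarnessLib
import Summits.Langlands.Statement
import Summits.Langlands.Langlands.Theses.DepthPrimeSplit
import Summits.Langlands.Langlands.Theses.SolvableReachSplit
import Summits.Langlands.Langlands.Theorems.TransientLevelSplitLevelFiniteness
import Summits.Langlands.Langlands.Theorems.WeakFernSplitFernSpread
import Summits.Langlands.Langlands.Theorems.FernRankSplitExchange
import Summits.Langlands.Langlands.Theorems.FernRankSplitFernSpread
import Summits.Langlands.Langlands.Theorems.FernTransitSplitFernRank
import Literature.NumberTheory.Automorphic.GLnAdelicStructureProofs

/-!
# ExactDescentSplit — lens-3 gen 32 node of the cell `decomp-langlands` (planner-decomp-langlands-lens-3-g32-0, 2026-08-31)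

TYPED-NOT-FILED (freeze).  Target BY NAME: DESCENT = `Summit.Langlands.Langlands.Theorems.FernTransit.SolvableProDescent` (gen 31's
declared residual, tagged IDEA-NEEDED «cyclic descent of APPROXIMATE eigen-systems», tree p835291), through which
TRANSIT ⟸ COVER ∧ ASCENT ∧ DESCENT, RANK ⟺ SST ∧ TRANSIT (`FernTransit.rankBound_iff_sst_and_transit`), FERN ⟺ HF ∧ RANK
(FERN = `Summit.Langlands.Langlands.Theses.DepthPrimeSplit.FernSpread`, stmt-Langlands-25024).

## The move (lens 3: ONE certified translation + a split beneath)
Gen 31 descended along the solvable layer L/K at rung C_b of the lineage's ladder (C_b = bounded weak pro-automorphy), where only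
APPROXIMATE cuspidal members are available and no cyclic descent of 𝒪/ℓ^m-valued Hecke points is in print.  But the lineage OWNS the
rest of the ladder over L:  C_b(L) ⟹ C(L) (g30's EXCHANGE, `FernRank.pro_of_boundedWeak`, PROVED) ⟹ WA(L) (CLASS over L = the parent
route's crux `DepthPrimeSplit.Classicality`, stmt-Langlands-25026, instantiated at the layer), and at the TOP rung descent is EXACT:
solvable descent of weak automorphy of an irreducible ρ is Arthur–Clozel cyclic descent (AMS-120 Ch. 3 Thm 4.2(d)) + strong multiplicity
one + the avatars of the descended forms selecting the twist (W⁺ = `DepthPrimeSplit.SatakeAvatarExistence`, stmt-Langlands-17415) +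
Chebotarev/Brauer–Nesbitt/Clifford — in print as ACC⁺ 2023 Prop. 6.5.13(2) (tree fact `ACC2023.solubleDescent_isAutomorphic`, CM/TR
regular sector) and ALREADY A REGISTERED ITEM in the lineage's own vocabulary: `SolvableReachSplit.SolvableDescent` (stmt-Langlands-29341,
support, «PRINT modulo W⁺»).  So the dial of this node is the predicate «ρ has a weakly-AUTOMORPHIC solvable semistable layer»
(`HasAutomorphicLayer`), and the translation is EXACT (excluded middle on the dial, modulo NOTHING):
  DESCENT ⟺ EDESCENT ∧ DARK                                   (`descent_iff_edescent_and_dark`)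
  EDESCENT = DESCENT restricted to ρ WITH an automorphic layer — «EXACT SOLVABLE DESCENT»: ⟸ SDWA (solvable descent of weak automorphy,
             `edescent_of_solvableWeakDescent`) ⟸ W⁺ ∧ SolvableDescent(29341) BY NAME (`solvableWeakDescent_of_items`): CLOSED modulo
             REGISTERED items; ATTACKABLE-NOW for the writer (no new crux);
  DARK     = DESCENT restricted to ρ with a bounded layer but NO automorphic layer — VOID modulo LCLASS («every bounded layer is an
             automorphic layer», `dark_of_layerClassicality`) ⟸ SSTCLASS (classicality for ρ semistable above ℓ) ⟸ CLASS(25026) BY NAME.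
Beneath, the second anatomy of TRANSIT replaces gen 31's ASCENT (whose C_w-half was IDEA-NEEDED-light) by print + registered pieces:
  TRANSIT ⟸ COVER ∧ RA ∧ LHF ∧ LCLASS ∧ EDESCENT              (`transit_of_top`;  ASCENT ⟸ RA ∧ LHF, DESCENT ⟸ EDESCENT ∧ LCLASS)
  RA    residual automorphy H1 ascends to the layers (weak base change of ONE cuspidal π, Arthur–Clozel 4.2(a)/(b); Eisenstein proviso);
  LHF   the Hecke fern over the layers ⟸ HF BY NAME (`layerHeckeFern_of_heckeFern`; HF is already a binder of the root frame).
NET (`closes_root`): DepthPrimeSplit's eight binders with FERN replaced by HF, SST, COVER, RA and the registered support SolvableDescent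
(29341) — CLASS and W⁺ were binders already.  Modulo print (COVER, RA, 29341 mod W⁺) and the parent route's registered cruxes (HF, CLASS,
W⁺) the FERN lineage's residual is SST ALONE (finite-slope rank: ATTACKABLE-mod-PRINT at l₀ = 0, BARRIER l₀ > 0); the IDEA-NEEDED tag
«approximate cyclic descent» LEAVES the lineage (census corner (e) dissolves: it was an artefact of descending below the top rung).
Every ledger-candidate piece is implied by B_w, hence by the summit (`pieces_of_langlands`; no EXCESS).  0 sorry.  Differs by construction
from lens-1 (dyadic grade), lens-2 (motivic), lens-4 (dihedral Clifford cell), lens-5 (odd-prime / tower door), lens-6 (leaf proofs) and from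
gen 31 (field axis for a LOCAL purpose at ℓ): here the layer TRANSPORTS, but EXACT weak automorphy only (a theorem-scheme of the trace formula).
-/

namespace Summit.Langlands.Langlands.Theorems.FernExactDescent

open scoped NumberField
open Filter Field IsDedekindDomain
open Literature.NumberTheory.GaloisRepresentations Literature.NumberTheory.Automorphic Literature.NumberTheory.PAdicHodge
open Summit.Langlands.Langlands.Theorems.TransientLevel Summit.Langlands.Langlands.Theorems.WeakFern
open Summit.Langlands.Langlands.Theorems.FernRank Summit.Langlands.Langlands.Theorems.FernTransit
open Summit.Langlands.Langlands.Theses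
set_option linter.dupNamespace false
set_option linter.unusedVariables false

/-! ## 24. Vocabulary: automorphic layers, solvable descent, layer-wise residual automorphy and Hecke fern -/

section Vocabulary
variable {K : Type} [Field K] [NumberField K] {n : ℕ} {ℓ : ℕ} [Fact ℓ.Prime]

/-- THE DIAL: some solvable semistable layer L/K (gen 31's `IsSemistableLayer`: Galois, solvable, ρ|_L irreducible, pinned-geometric,
semistable above ℓ) carries EXACT weak automorphy of ρ|_L (an L-algebraic cuspidal Π of GL_n(𝔸_L), Satake–Frobenius compatible a.e.). -/
def HasAutomorphicLayer (ι : PadicAlgCl ℓ ≃+* ℂ) (ρ : FramedGaloisRep K (PadicAlgCl ℓ) n) : Prop :=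
  ∃ (L : Type) (_ : Field L) (_ : NumberField L) (_ : Algebra K L), IsSemistableLayer ρ L ∧
    ∀ hcptL : isCompact_glFiniteIntegralLevel n L, IsWeaklyAutomorphic hcptL ι (ρ.restrictField L)

/-- SOLVABLE DESCENT OF WEAK AUTOMORPHY for ρ: from every finite Galois L/K with solvable group on which ρ stays irreducible, weak
automorphy of ρ|_L descends to ρ (the body of SDWA; verbatim the tail of `SolvableReachSplit.SolvableDescent`, stmt-Langlands-29341). -/
def DescendsSolvably (hcpt : isCompact_glFiniteIntegralLevel n K) (ι : PadicAlgCl ℓ ≃+* ℂ) (ρ : FramedGaloisRep K (PadicAlgCl ℓ) n) :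
    Prop :=
  ∀ (L : Type) [Field L] [NumberField L] [Algebra K L], IsGalois K L → IsSolvable (L ≃ₐ[K] L) →
    ∀ hcptL : isCompact_glFiniteIntegralLevel n L, (ρ.restrictField L).toGaloisRep.IsIrreducible →
      IsWeaklyAutomorphic hcptL ι (ρ.restrictField L) → IsWeaklyAutomorphic hcpt ι ρ

/-- residual automorphy H1 of ρ|_L on every solvable semistable layer (the conclusion of RA). -/
def LayerResidual (ι : PadicAlgCl ℓ ≃+* ℂ) (ρ : FramedGaloisRep K (PadicAlgCl ℓ) n) : Prop :=
  ∀ (L : Type) [Field L] [NumberField L] [Algebra K L], IsSemistableLayer ρ L →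
    ∀ hcptL : isCompact_glFiniteIntegralLevel n L, IsResiduallyAutomorphic hcptL ι (ρ.restrictField L)

/-- the Hecke fern H1 ⟹ C_w for ρ|_L on every solvable semistable layer (the conclusion of LHF). -/
def LayerHecke (ι : PadicAlgCl ℓ ≃+* ℂ) (ρ : FramedGaloisRep K (PadicAlgCl ℓ) n) : Prop :=
  ∀ (L : Type) [Field L] [NumberField L] [Algebra K L], IsSemistableLayer ρ L →
    ∀ hcptL : isCompact_glFiniteIntegralLevel n L,
      IsResiduallyAutomorphic hcptL ι (ρ.restrictField L) → IsWeaklyProAutomorphic hcptL ι (ρ.restrictField L)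

end Vocabulary

/-! ## 25. The items (over the landed vocabulary of the lineage; `Frame` = g29's common frame) -/

/-- EDESCENT · EXACT SOLVABLE DESCENT · crux rank 2 of the split · WEAKER than DESCENT (`edescent_of_descent`: an automorphic layer is a
bounded layer; probe EDESCENT ↛ DESCENT) · CLOSED MODULO REGISTERED ITEMS: ⟸ SDWA ⟸ W⁺ (stmt-Langlands-17415) ∧ SolvableDescent
(stmt-Langlands-29341, support, PRINT mod W⁺: Arthur–Clozel Ch. 3 Thm 4.2(d) + III.3.1 fibres, strong multiplicity one, Chebotarev /
Brauer–Nesbitt / Clifford; ACC⁺ 2023 Prop. 6.5.13(2)) — `edescent_of_items` · ATTACKABLE-NOW.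
DESCENT's binders and hypotheses VERBATIM with «bounded layer» strengthened to «automorphic layer»; conclusion C_b. -/
def AutomorphicLayerDescent : Prop :=
  Frame fun hcpt ι ρ => IsResiduallyAutomorphic hcpt ι ρ → IsWeaklyProAutomorphic hcpt ι ρ →
    HasAutomorphicLayer ι ρ → IsBoundedlyWeaklyProAutomorphic hcpt ι ρ

/-- DARK · DARK-LAYER DESCENT · crux rank 3 of the split (the formal complement of the dial) · WEAKER than DESCENT (`dark_of_descent`;
probe DARK ↛ DESCENT) · VOID modulo LCLASS (`dark_of_layerClassicality`), hence modulo CLASS (stmt-Langlands-25026) · UNDECIDED whether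
two-valued; never to be staffed on its own (its content is classicality over the layer). DESCENT plus «ρ has NO automorphic layer». -/
def DarkLayerDescent : Prop :=
  Frame fun hcpt ι ρ => IsResiduallyAutomorphic hcpt ι ρ → IsWeaklyProAutomorphic hcpt ι ρ →
    HasBoundedLayer ι ρ → ¬ HasAutomorphicLayer ι ρ → IsBoundedlyWeaklyProAutomorphic hcpt ι ρ

/-- LCLASS · LAYER CLASSICALITY · support · every bounded layer of ρ is an automorphic layer: EXCHANGE over L (PROVED, g30) followed by
classicality C ⟹ WA over L for the SEMISTABLE ρ|_L · WEAKER than CLASS (`layerClassicality_of_classicality`), ⟸ SSTCLASS ·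
Langlands-implied · closes DARK. -/
def LayerClassicality : Prop :=
  Frame fun _ ι ρ => HasBoundedLayer ι ρ → HasAutomorphicLayer ι ρ

/-- SSTCLASS · SEMISTABLE CLASSICALITY · support · CLASS (= `DepthPrimeSplit.Classicality`: C ⟹ WA) restricted to ρ semistable above ℓ
(finite slope after enlarging coefficients) · WEAKER than CLASS (`semistableClassicality_of_classicality`) · ATTACKABLE-mod-PRINT at
l₀ = 0 (overconvergent finite-slope classicality: Kisin 2003, Breuil–Hellmann–Schraen 2017/2019), same BARRIER as CLASS at l₀ > 0. -/
def SemistableClassicality : Prop :=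
  Frame fun hcpt ι ρ => IsSemistableAbove ρ → IsProAutomorphic hcpt ι ρ → IsWeaklyAutomorphic hcpt ι ρ

/-- SDWA · SOLVABLE DESCENT OF WEAK AUTOMORPHY · support · for irreducible pinned-geometric ρ and solvable Galois L/K with ρ|_L irreducible,
WA(ρ|_L) ⟹ WA(ρ) · PRINT modulo W⁺ (= registered `SolvableReachSplit.SolvableDescent` 29341 with W⁺ = 17415 detached:
`solvableWeakDescent_of_items`) · B_w-implied (`solvableWeakDescent_of_weak`). -/
def SolvableWeakDescent : Prop :=
  Frame fun hcpt ι ρ => DescendsSolvably hcpt ι ρ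

/-- RA · RESIDUAL ASCENT · support · given TRANSIT's K-side data (H1, C_w), residual automorphy H1 holds for ρ|_L on every solvable
semistable layer · the H1-half of gen 31's ASCENT (`residualAscent_of_ascent`) · PRINT modulo the Eisenstein proviso (weak base change of
the single residual approximant π₁ along a cyclic prime tower: Arthur–Clozel Ch. 3 Thm 4.2(a) when π₁ ≇ π₁ ⊗ η — tree
`BaseFieldAscent.ArthurClozelCuspidalBaseChange` 19599 / fact `baseChange_cyclic_cuspidal`; in the induced case 4.2(b) the lift is
isobaric and a CUSPIDAL 1-approximant over L must be re-chosen: level-raising / Eisenstein-congruence input, IDEA-NEEDED-light) ·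
Langlands-implied (`residualAscent_of_weak`). -/
def ResidualAscent : Prop :=
  Frame fun hcpt ι ρ => IsResiduallyAutomorphic hcpt ι ρ → IsWeaklyProAutomorphic hcpt ι ρ → LayerResidual ι ρ

/-- LHF · LAYER HECKE FERN · support · HF (= `WeakFern.HeckeFern`: H1 ⟹ C_w) for ρ|_L on every solvable semistable layer · WEAKER than HF
(`layerHeckeFern_of_heckeFern`, an instantiation over L) · together with RA it gives gen 31's ASCENT (`ascent_of_residualAscent_of_layerHeckeFern`). -/
def LayerHeckeFern : Prop :=
  Frame fun _ ι ρ => LayerHecke ι ρ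

/-! ## 26. Kernel -/

section Kernel

variable {K : Type} [Field K] [NumberField K] {n : ℕ} {ℓ : ℕ} [Fact ℓ.Prime]

omit [NumberField K] in
/-- an automorphic layer is a bounded layer: WA(L) ⟹ C(L) (`pro_of_weakly`, g24) ⟹ C_b(L) (`boundedWeak_of_pro`, g30). -/
theorem hasBoundedLayer_of_hasAutomorphicLayer {ι : PadicAlgCl ℓ ≃+* ℂ} {ρ : FramedGaloisRep K (PadicAlgCl ℓ) n}
    (h : HasAutomorphicLayer ι ρ) : HasBoundedLayer ι ρ := by
  obtain ⟨L, _, _, _, hLay, hWA⟩ := h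
  refine ⟨L, ‹Field L›, ‹NumberField L›, ‹Algebra K L›, hLay, fun hcptL => ?_⟩
  exact boundedWeak_of_pro (pro_of_weakly (hWA hcptL))

omit [NumberField K] in
/-- an automorphic layer is in particular a semistable layer. -/
theorem hasSemistableLayer_of_hasAutomorphicLayer {ι : PadicAlgCl ℓ ≃+* ℂ} {ρ : FramedGaloisRep K (PadicAlgCl ℓ) n}
    (h : HasAutomorphicLayer ι ρ) : HasSemistableLayer ρ :=
  hasSemistableLayer_of_hasBoundedLayer (hasBoundedLayer_of_hasAutomorphicLayer h)

/-- the summit gives exact WEAK automorphy for every irreducible pinned-geometric ρ over every number field (`Rec.pst` is Fontaine's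
pinned datum by `rfl`; g24's proof shape). -/
theorem weakly_of_langlands (hL : _root_.Langlands) (hcpt : isCompact_glFiniteIntegralLevel n K) (hn : 0 < n) (ι : PadicAlgCl ℓ ≃+* ℂ)
    (ρ : FramedGaloisRep K (PadicAlgCl ℓ) n) (hirr : ρ.toGaloisRep.IsIrreducible) (hgeo : IsPinnedGeometric ρ) :
    IsWeaklyAutomorphic hcpt ι ρ := by
  obtain ⟨⟨Rec⟩, h⟩ := hL K
  obtain ⟨π, hπ, hcorr⟩ := (h Rec n hn hcpt).2 ℓ ι ρ hirr ⟨hgeo.1, fun v hv => hgeo.2 v hv⟩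
  exact ⟨π, hπ, hcorr.1⟩

end Kernel

/-- Langlands ⟹ B_w (weak geometric automorphy, `PrimeSwitchSplit.WeakGeometricAutomorphy`; private like g29's twin, so that no
audit reads a conditional as a proof of the PrimeSwitchSplit item). -/
private theorem weak_of_langlands (hL : _root_.Langlands) : PrimeSwitchSplit.WeakGeometricAutomorphy :=
  fun K _ _ n hcpt hn ℓ _ ι ρ hirr hgeo => weakly_of_langlands hL hcpt hn ι ρ hirr hgeo

/-! ## 27. The EQUIV: DESCENT ⟺ EDESCENT ∧ DARK (modulo NOTHING) -/

/-- DESCENT ⟹ EDESCENT (an automorphic layer is a bounded layer). -/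
theorem edescent_of_descent (h : SolvableProDescent) : AutomorphicLayerDescent :=
  fun K _ _ n hcpt hn ℓ _ ι ρ hirr hgeo h1 hw hA => h K n hcpt hn ℓ ι ρ hirr hgeo h1 hw (hasBoundedLayer_of_hasAutomorphicLayer hA)

/-- DESCENT ⟹ DARK (drop the darkness hypothesis). -/
theorem dark_of_descent (h : SolvableProDescent) : DarkLayerDescent :=
  fun K _ _ n hcpt hn ℓ _ ι ρ hirr hgeo h1 hw hB _ => h K n hcpt hn ℓ ι ρ hirr hgeo h1 hw hB

/-- EDESCENT ∧ DARK ⟹ DESCENT (excluded middle on the dial). -/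
theorem descent_of_edescent_of_dark (hE : AutomorphicLayerDescent) (hD : DarkLayerDescent) : SolvableProDescent := by
  intro K _ _ n hcpt hn ℓ _ ι ρ hirr hgeo h1 hw hB
  rcases Classical.em (HasAutomorphicLayer ι ρ) with hA | hA
  · exact hE K n hcpt hn ℓ ι ρ hirr hgeo h1 hw hA
  · exact hD K n hcpt hn ℓ ι ρ hirr hgeo h1 hw hB hA

/-- THE TRANSLATION: DESCENT ⟺ EDESCENT ∧ DARK. -/
theorem descent_iff_edescent_and_dark : SolvableProDescent ↔ AutomorphicLayerDescent ∧ DarkLayerDescent :=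
  ⟨fun h => ⟨edescent_of_descent h, dark_of_descent h⟩, fun h => descent_of_edescent_of_dark h.1 h.2⟩

/-- the translation carried to TRANSIT's anatomy: TRANSIT ⟸ COVER ∧ ASCENT ∧ EDESCENT ∧ DARK. -/
theorem transit_of_four (hCo : SemistableSolvableCover) (hA : SolvableWeakAscent) (hE : AutomorphicLayerDescent) (hD : DarkLayerDescent) :
    SolvableTransit :=
  transit_of_pieces hCo hA (descent_of_edescent_of_dark hE hD)

/-! ## 28. The split beneath: DARK is classicality over the layer, EDESCENT is registered print -/

/-- LCLASS ⟹ DARK (the dark cell is EMPTY under layer classicality). -/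
theorem dark_of_layerClassicality (hL : LayerClassicality) : DarkLayerDescent :=
  fun K _ _ n hcpt hn ℓ _ ι ρ hirr hgeo _ _ hB hA => absurd (hL K n hcpt hn ℓ ι ρ hirr hgeo hB) hA

/-- DESCENT ⟸ EDESCENT ∧ LCLASS (the working form of the split). -/
theorem descent_of_edescent_of_layerClassicality (hE : AutomorphicLayerDescent) (hL : LayerClassicality) : SolvableProDescent :=
  fun K _ _ n hcpt hn ℓ _ ι ρ hirr hgeo h1 hw hB => hE K n hcpt hn ℓ ι ρ hirr hgeo h1 hw (hL K n hcpt hn ℓ ι ρ hirr hgeo hB)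

/-- SSTCLASS ⟹ LCLASS: on a bounded layer, EXCHANGE (`pro_of_boundedWeak`, PROVED) gives C(L), and ρ|_L is irreducible, pinned-geometric
and semistable above ℓ by the layer predicate, so semistable classicality over L gives WA(L). -/
theorem layerClassicality_of_semistableClassicality (hS : SemistableClassicality) : LayerClassicality := by
  intro K _ _ n hcpt hn ℓ _ ι ρ hirr hgeo hB
  obtain ⟨L, _, _, _, hLay, hb⟩ := hB
  refine ⟨L, ‹Field L›, ‹NumberField L›, ‹Algebra K L›, hLay, fun hcptL => ?_⟩
  exact hS L n hcptL hn ℓ ι (ρ.restrictField L) hLay.2.2.1 hLay.2.2.2.1 hLay.2.2.2.2 (pro_of_boundedWeak hLay.2.2.2.1.1 (hb hcptL))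

/-- CLASS ⟹ SSTCLASS (drop the semistability hypothesis; CLASS = Frame (C → WA) by `WeakFern.classicality_iff_frame`). -/
theorem semistableClassicality_of_classicality (hC : DepthPrimeSplit.Classicality) : SemistableClassicality :=
  fun K _ _ n hcpt hn ℓ _ ι ρ hirr hgeo _ hp => hC K n hcpt hn ℓ ι ρ hirr hgeo hp

/-- CLASS ⟹ LCLASS. -/
theorem layerClassicality_of_classicality (hC : DepthPrimeSplit.Classicality) : LayerClassicality :=
  layerClassicality_of_semistableClassicality (semistableClassicality_of_classicality hC)

/-- SDWA ⟹ EDESCENT: descend EXACT weak automorphy from the automorphic layer (Galois, solvable, ρ|_L irreducible by the layer predicate;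
the level datum over L exists by `isCompact_glFiniteIntegralLevel_holds`), then WA(K) ⟹ C(K) ⟹ C_b(K) down the lineage's own ladder. -/
theorem edescent_of_solvableWeakDescent (hS : SolvableWeakDescent) : AutomorphicLayerDescent := by
  intro K _ _ n hcpt hn ℓ _ ι ρ hirr hgeo _ _ hA
  obtain ⟨L, _, _, _, hLay, hWA⟩ := hA
  have hcptL : isCompact_glFiniteIntegralLevel n L := isCompact_glFiniteIntegralLevel_holds n L
  have hK : IsWeaklyAutomorphic hcpt ι ρ := hS K n hcpt hn ℓ ι ρ hirr hgeo L hLay.1 hLay.2.1 hcptL hLay.2.2.1 (hWA hcptL)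
  exact boundedWeak_of_pro (pro_of_weakly hK)

/-- SDWA ⟸ W⁺ ∧ SolvableDescent BY NAME: the registered support `SolvableReachSplit.SolvableDescent` (stmt-Langlands-29341) is literally
W⁺ → SDWA with W⁺ = `DepthPrimeSplit.SatakeAvatarExistence` (stmt-Langlands-17415, identical text) inlined as its first hypothesis. -/
theorem solvableWeakDescent_of_items (hW : DepthPrimeSplit.SatakeAvatarExistence) (hSD : SolvableReachSplit.SolvableDescent) :
    SolvableWeakDescent :=
  fun K _ _ n hcpt hn ℓ _ ι ρ hirr hgeo L _ _ _ hGal hSolv hcptL hirrL hWA =>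
    hSD hW K n hcpt hn ℓ ι ρ hirr hgeo L hGal hSolv hcptL hirrL hWA

/-- EDESCENT ⟸ W⁺ ∧ SolvableDescent (both REGISTERED): the rank-2 piece needs no new crux. -/
theorem edescent_of_items (hW : DepthPrimeSplit.SatakeAvatarExistence) (hSD : SolvableReachSplit.SolvableDescent) :
    AutomorphicLayerDescent :=
  edescent_of_solvableWeakDescent (solvableWeakDescent_of_items hW hSD)

/-- DESCENT ⟸ REGISTERED ITEMS ONLY: W⁺ (17415) ∧ SolvableDescent (29341) ∧ CLASS (25026).  Gen 31's IDEA-NEEDED residual is discharged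
modulo items the parent route and its sibling already carry. -/
theorem descent_of_registered (hW : DepthPrimeSplit.SatakeAvatarExistence) (hSD : SolvableReachSplit.SolvableDescent)
    (hC : DepthPrimeSplit.Classicality) : SolvableProDescent :=
  descent_of_edescent_of_layerClassicality (edescent_of_items hW hSD) (layerClassicality_of_classicality hC)

/-! ## 29. The second anatomy of TRANSIT: ASCENT ⟸ RA ∧ LHF, hence TRANSIT ⟸ COVER ∧ RA ∧ LHF ∧ LCLASS ∧ EDESCENT -/

/-- ASCENT ⟹ RA (its H1-half). -/
theorem residualAscent_of_ascent (hA : SolvableWeakAscent) : ResidualAscent :=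
  fun K _ _ n hcpt hn ℓ _ ι ρ hirr hgeo h1 hw L _ _ _ hLay hcptL => (hA K n hcpt hn ℓ ι ρ hirr hgeo h1 hw L hLay hcptL).1

/-- HF ⟹ LHF (instantiate the Hecke fern over L at ρ|_L, irreducible and pinned-geometric by the layer predicate). -/
theorem layerHeckeFern_of_heckeFern (hH : HeckeFern) : LayerHeckeFern :=
  fun K _ _ n hcpt hn ℓ _ ι ρ hirr hgeo L _ _ _ hLay hcptL h1L => hH L n hcptL hn ℓ ι (ρ.restrictField L) hLay.2.2.1 hLay.2.2.2.1 h1L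

/-- RA ∧ LHF ⟹ ASCENT (gen 31's ASCENT re-assembled from its H1-half and the Hecke fern upstairs). -/
theorem ascent_of_residualAscent_of_layerHeckeFern (hR : ResidualAscent) (hF : LayerHeckeFern) : SolvableWeakAscent :=
  fun K _ _ n hcpt hn ℓ _ ι ρ hirr hgeo h1 hw L _ _ _ hLay hcptL =>
    have h1L := hR K n hcpt hn ℓ ι ρ hirr hgeo h1 hw L hLay hcptL
    ⟨h1L, hF K n hcpt hn ℓ ι ρ hirr hgeo L hLay hcptL h1L⟩

/-- TRANSIT ⟸ COVER ∧ RA ∧ LHF ∧ LCLASS ∧ EDESCENT (all five used: COVER gives the layer, RA and LHF carry H1 and C_w up, the bracket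
bounds the rank upstairs, LCLASS makes the bounded layer automorphic, EDESCENT brings C_b down exactly). -/
theorem transit_of_top (hCo : SemistableSolvableCover) (hR : ResidualAscent) (hF : LayerHeckeFern) (hL : LayerClassicality)
    (hE : AutomorphicLayerDescent) : SolvableTransit :=
  transit_of_pieces hCo (ascent_of_residualAscent_of_layerHeckeFern hR hF) (descent_of_edescent_of_layerClassicality hE hL)

/-- TRANSIT ⟸ COVER ∧ ASCENT ∧ [W⁺ ∧ SolvableDescent ∧ CLASS] (gen 31's anatomy with DESCENT discharged by registered items). -/
theorem transit_of_registered (hCo : SemistableSolvableCover) (hA : SolvableWeakAscent) (hW : DepthPrimeSplit.SatakeAvatarExistence)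
    (hSD : SolvableReachSplit.SolvableDescent) (hC : DepthPrimeSplit.Classicality) : SolvableTransit :=
  transit_of_pieces hCo hA (descent_of_registered hW hSD hC)

/-- TRANSIT ⟸ COVER ∧ RA ∧ [HF ∧ W⁺ ∧ SolvableDescent ∧ CLASS] (the top anatomy with every bracketed input registered). -/
theorem transit_of_top_registered (hCo : SemistableSolvableCover) (hR : ResidualAscent) (hH : HeckeFern)
    (hW : DepthPrimeSplit.SatakeAvatarExistence) (hSD : SolvableReachSplit.SolvableDescent) (hC : DepthPrimeSplit.Classicality) :
    SolvableTransit :=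
  transit_of_top hCo hR (layerHeckeFern_of_heckeFern hH) (layerClassicality_of_classicality hC) (edescent_of_items hW hSD)

/-! ## 30. No EXCESS: every ledger-candidate piece is implied by B_w, hence by the summit -/

/-- B_w ⟹ SDWA (the conclusion outright). -/
theorem solvableWeakDescent_of_weak (hB : PrimeSwitchSplit.WeakGeometricAutomorphy) : SolvableWeakDescent :=
  fun K _ _ n hcpt hn ℓ _ ι ρ hirr hgeo L _ _ _ _ _ _ _ _ => hB K n hcpt hn ℓ ι ρ hirr hgeo

/-- B_w ⟹ LCLASS (B_w over the layer). -/
theorem layerClassicality_of_weak (hB : PrimeSwitchSplit.WeakGeometricAutomorphy) : LayerClassicality := by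
  intro K _ _ n hcpt hn ℓ _ ι ρ hirr hgeo hBd
  obtain ⟨L, _, _, _, hLay, _⟩ := hBd
  refine ⟨L, ‹Field L›, ‹NumberField L›, ‹Algebra K L›, hLay, fun hcptL => ?_⟩
  exact hB L n hcptL hn ℓ ι (ρ.restrictField L) hLay.2.2.1 hLay.2.2.2.1

/-- B_w ⟹ SSTCLASS. -/
theorem semistableClassicality_of_weak (hB : PrimeSwitchSplit.WeakGeometricAutomorphy) : SemistableClassicality :=
  fun K _ _ n hcpt hn ℓ _ ι ρ hirr hgeo _ _ => hB K n hcpt hn ℓ ι ρ hirr hgeo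

/-- B_w ⟹ EDESCENT. -/
theorem edescent_of_weak (hB : PrimeSwitchSplit.WeakGeometricAutomorphy) : AutomorphicLayerDescent :=
  edescent_of_solvableWeakDescent (solvableWeakDescent_of_weak hB)

/-- B_w ⟹ DARK. -/
theorem dark_of_weak (hB : PrimeSwitchSplit.WeakGeometricAutomorphy) : DarkLayerDescent :=
  dark_of_layerClassicality (layerClassicality_of_weak hB)

/-- B_w ⟹ RA (B_w over the layer, then WA ⟹ C ⟹ H1). -/
theorem residualAscent_of_weak (hB : PrimeSwitchSplit.WeakGeometricAutomorphy) : ResidualAscent :=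
  fun K _ _ n hcpt hn ℓ _ ι ρ hirr hgeo _ _ L _ _ _ hLay hcptL =>
    residual_of_pro (pro_of_weakly (hB L n hcptL hn ℓ ι (ρ.restrictField L) hLay.2.2.1 hLay.2.2.2.1))

/-- B_w ⟹ LHF. -/
theorem layerHeckeFern_of_weak (hB : PrimeSwitchSplit.WeakGeometricAutomorphy) : LayerHeckeFern :=
  layerHeckeFern_of_heckeFern (heckeFern_of_weak hB)

/-- B_w-IMPLIED certificate for all seven pieces. -/
theorem pieces_of_weak (hB : PrimeSwitchSplit.WeakGeometricAutomorphy) :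
    AutomorphicLayerDescent ∧ DarkLayerDescent ∧ LayerClassicality ∧ SemistableClassicality ∧ SolvableWeakDescent ∧
      ResidualAscent ∧ LayerHeckeFern :=
  ⟨edescent_of_weak hB, dark_of_weak hB, layerClassicality_of_weak hB, semistableClassicality_of_weak hB, solvableWeakDescent_of_weak hB,
    residualAscent_of_weak hB, layerHeckeFern_of_weak hB⟩

/-- ROOT-IMPLIED certificate: the summit implies EDESCENT, DARK, LCLASS, SSTCLASS, SDWA, RA, LHF (no EXCESS). -/
theorem pieces_of_langlands (hL : _root_.Langlands) :
    AutomorphicLayerDescent ∧ DarkLayerDescent ∧ LayerClassicality ∧ SemistableClassicality ∧ SolvableWeakDescent ∧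
      ResidualAscent ∧ LayerHeckeFern :=
  pieces_of_weak (weak_of_langlands hL)

/-- necessity from the target: DESCENT ⟹ EDESCENT ∧ DARK; RANK ⟹ both; FERN ⟹ both. -/
theorem pieces_of_rankBound (h : FernRankBound) : AutomorphicLayerDescent ∧ DarkLayerDescent :=
  ⟨edescent_of_descent (descent_of_rankBound h), dark_of_descent (descent_of_rankBound h)⟩

/-- necessity from the target FERN: `DepthPrimeSplit.FernSpread` ⟹ EDESCENT ∧ DARK. -/
theorem pieces_of_fernSpread (hF : DepthPrimeSplit.FernSpread) : AutomorphicLayerDescent ∧ DarkLayerDescent :=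
  pieces_of_rankBound (rankBound_of_fernSpread hF)

/-! ## 31. Frames: residual (DESCENT, TRANSIT, RANK by name), target (FERN by name), root (`_root_.Langlands`) -/

/-- residual frame at DESCENT: EDESCENT → LCLASS → DESCENT. -/
theorem closes_descent (hE : AutomorphicLayerDescent) (hL : LayerClassicality) : SolvableProDescent :=
  descent_of_edescent_of_layerClassicality hE hL

/-- residual frame at RANK through gen 31's anatomy: SST → COVER → ASCENT → EDESCENT → LCLASS → RANK. -/
theorem closes_residual (h₁ : SemistableRankBound) (hCo : SemistableSolvableCover) (hA : SolvableWeakAscent)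
    (hE : AutomorphicLayerDescent) (hL : LayerClassicality) : FernRankBound :=
  FernTransit.closes_residual h₁ (transit_of_pieces hCo hA (descent_of_edescent_of_layerClassicality hE hL))

/-- residual frame at RANK through the top anatomy: SST → COVER → RA → LHF → LCLASS → EDESCENT → RANK. -/
theorem closes_residual_top (h₁ : SemistableRankBound) (hCo : SemistableSolvableCover) (hR : ResidualAscent) (hF : LayerHeckeFern)
    (hL : LayerClassicality) (hE : AutomorphicLayerDescent) : FernRankBound :=
  FernTransit.closes_residual h₁ (transit_of_top hCo hR hF hL hE)

/-- residual frame at RANK with every dischargeable piece discharged BY NAME: SST → COVER → RA → [HF, W⁺, SolvableDescent, CLASS] → RANK. -/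
theorem closes_residual_registered (h₁ : SemistableRankBound) (hCo : SemistableSolvableCover) (hR : ResidualAscent) (hH : HeckeFern)
    (hW : DepthPrimeSplit.SatakeAvatarExistence) (hSD : SolvableReachSplit.SolvableDescent) (hC : DepthPrimeSplit.Classicality) :
    FernRankBound :=
  FernTransit.closes_residual h₁ (transit_of_top_registered hCo hR hH hW hSD hC)

/-- target frame (child-route `closes` shape): HF → SST → COVER → RA → LCLASS → EDESCENT → FERN by name (LHF from HF). -/
theorem closes_target (hH : HeckeFern) (h₁ : SemistableRankBound) (hCo : SemistableSolvableCover) (hR : ResidualAscent)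
    (hL : LayerClassicality) (hE : AutomorphicLayerDescent) : DepthPrimeSplit.FernSpread :=
  FernTransit.closes_target hH h₁ (transit_of_top hCo hR (layerHeckeFern_of_heckeFern hH) hL hE)

/-- root frame: `DepthPrimeSplit.closes` with FERN replaced by HF, SST, COVER, RA and the registered support SolvableDescent (29341);
CLASS (25026) and W⁺ (17415), already binders, absorb LCLASS and the avatar half of EDESCENT.  Twelve binders → the summit. -/
theorem closes_root (hD : DepthPrimeSplit.DyadicSeed) (hO : DepthPrimeSplit.OddPrimeSeed) (hH : HeckeFern) (h₁ : SemistableRankBound)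
    (hCo : SemistableSolvableCover) (hR : ResidualAscent) (hSD : SolvableReachSplit.SolvableDescent) (hC : DepthPrimeSplit.Classicality)
    (hW : DepthPrimeSplit.SatakeAvatarExistence) (hP : DepthPrimeSplit.PadicMemberCompatibility)
    (hA : DepthPrimeSplit.CompatibilityAwayFromLR) (hRD : DepthPrimeSplit.CanonicalReciprocityData) : _root_.Langlands :=
  FernTransit.closes_root hD hO hH h₁ (transit_of_top_registered hCo hR hH hW hSD hC) hC hW hP hA hRD

/-- root frame keeping gen 31's ASCENT instead of RA (twelve binders). -/
theorem closes_root_ascent (hD : DepthPrimeSplit.DyadicSeed) (hO : DepthPrimeSplit.OddPrimeSeed) (hH : HeckeFern)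
    (h₁ : SemistableRankBound) (hCo : SemistableSolvableCover) (hAs : SolvableWeakAscent) (hSD : SolvableReachSplit.SolvableDescent)
    (hC : DepthPrimeSplit.Classicality) (hW : DepthPrimeSplit.SatakeAvatarExistence) (hP : DepthPrimeSplit.PadicMemberCompatibility)
    (hA : DepthPrimeSplit.CompatibilityAwayFromLR) (hRD : DepthPrimeSplit.CanonicalReciprocityData) : _root_.Langlands :=
  FernTransit.closes_root hD hO hH h₁ (transit_of_registered hCo hAs hW hSD hC) hC hW hP hA hRD

/-- root frame with the two new OPEN pieces explicit (EDESCENT, LCLASS) instead of their registered dischargers (thirteen binders). -/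
theorem closes_root_pieces (hD : DepthPrimeSplit.DyadicSeed) (hO : DepthPrimeSplit.OddPrimeSeed) (hH : HeckeFern)
    (h₁ : SemistableRankBound) (hCo : SemistableSolvableCover) (hR : ResidualAscent) (hL : LayerClassicality)
    (hE : AutomorphicLayerDescent) (hC : DepthPrimeSplit.Classicality) (hW : DepthPrimeSplit.SatakeAvatarExistence)
    (hP : DepthPrimeSplit.PadicMemberCompatibility) (hA : DepthPrimeSplit.CompatibilityAwayFromLR)
    (hRD : DepthPrimeSplit.CanonicalReciprocityData) : _root_.Langlands :=
  FernTransit.closes_root hD hO hH h₁ (transit_of_top hCo hR (layerHeckeFern_of_heckeFern hH) hL hE) hC hW hP hA hRD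

end Summit.Langlands.Langlands.Theorems.FernExactDescent
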